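import Mathlib
import Summits.KontsevichZagierPeriods.KontsevichZagierPeriods.Theorems.SoloInformedHarmonicReps
import HarnessLib
import HarnessLib.Audit

/-!
# SoloInformed — block labellings with a letter of arbitrary size (Hoffman's relation, file 1)

Solo programme `solo-KontsevichZagierPeriods-informed`, session s48 (PROGRAMME L; pure
combinatorics).

File `SoloInformedHarmonicLabels` computes fibres, validity, indices and chain products of the
insertion / merging labellings `LabIns i`, `LabMerge i` of the cube `(0,1)^{M+1}`,
`M + 1 = (m+1) + (a+2)`, for a letter of size `a + 2 ≥ 2` (the harmonic product with `ζ(a+2)`).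
Hoffman's relation needs the SAME labellings for a letter of size `c = 1` (one extra coordinate
`Y`, `M = m + 1`): the definitions `soloInformedLabIns`, `soloInformedLabMerge`, `soloInformedQU`,
`soloInformedYB` are already general, and this file re-proves the eight lemmas for an arbitrary
letter size `c` (`hM : m + c = M`): fibres `u_t / c / u_{t-1}` and `u_t (+c at i)`, validity
(for `LabIns` with `1 ≤ c` and `1 ≤ i`, so that block `0` stays `u₀ ≥ 2`), indices
`u.take i ++ c :: u.drop i` and `u.take i ++ (c + u_i) :: u.drop (i+1)`; and, in the Hoffman case
`M = m + 1`, the chains `ins_i(Y; Q)`, `merge_i(Y; Q)` of `SoloInformedHarmonicGQ` with `Y = w_{m+1}`.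

References: Hoffman 1992 §2, Thm 5.1; Hoffman 1997 §2.
-/

noncomputable section

open Literature.NumberTheory.Transcendental
open Literature.NumberTheory.Transcendental.KZ

namespace Summit.KontsevichZagierPeriods.KontsevichZagierPeriods.Theorems

section labs

variable (M : ℕ) {u : List ℕ} {m i c k : ℕ} (hu : MZV.IsAdmissible u) (hw : u.sum = m + 1)
  (hk : u.length = k + 1) (hM : m + c = M)
include hu hw hk hM

/-- **Fibres of `LabIns i`** (letter of size `c`): `u_t` below `i`, `c` at `i`, `u_{t-1}` above. -/
theorem soloInformed_fib_labInsC (hi : i ≤ k + 1) {t : ℕ} (ht : t ≤ k + 1) :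
    soloInformedFib (soloInformedLabIns M u m i) t =
      if h : t < i then u[t]'(by omega) else if t = i then c else u[t - 1]'(by omega) := by
  unfold soloInformedFib
  split_ifs with h1 h2
  · rw [← soloInformed_card_fibreU hu.1 hw hk (by omega : m + 1 ≤ M + 1) (by omega : t ≤ k)]
    congr 1
    ext l
    simp only [Finset.mem_filter, Finset.mem_univ, true_and, soloInformedLabIns]
    split_ifs with h3 h4 <;> omega
  · subst h2
    have hS : Finset.univ.filter (fun l : Fin (M + 1) => soloInformedLabIns M u m t l = t) =
        Finset.univ.filter (fun l : Fin (M + 1) => m + 1 ≤ l.1) := by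
      ext l
      simp only [Finset.mem_filter, Finset.mem_univ, true_and, soloInformedLabIns]
      split_ifs with h3 h4 <;> omega
    rw [hS]
    exact soloInformed_card_filter_le_val (by omega)
  · rw [← soloInformed_card_fibreU hu.1 hw hk (by omega : m + 1 ≤ M + 1) (by omega : t - 1 ≤ k)]
    congr 1
    ext l
    simp only [Finset.mem_filter, Finset.mem_univ, true_and, soloInformedLabIns]
    split_ifs with h3 h4 <;> omega

/-- **Fibres of `LabMerge i`** (letter of size `c`): `u_t`, plus `c` at `t = i`. -/
theorem soloInformed_fib_labMergeC (hi : i ≤ k) {t : ℕ} (ht : t ≤ k) :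
    soloInformedFib (soloInformedLabMerge M u m i) t =
      if t = i then c + u[t]'(by omega) else u[t]'(by omega) := by
  unfold soloInformedFib
  split_ifs with h1
  · subst h1
    have hS : Finset.univ.filter (fun l : Fin (M + 1) => soloInformedLabMerge M u m t l = t) =
        Finset.univ.filter (fun l : Fin (M + 1) => m + 1 ≤ l.1) ∪
          Finset.univ.filter (fun l : Fin (M + 1) => l.1 < m + 1 ∧ soloInformedLabU u l = t) := by
      ext l
      simp only [Finset.mem_filter, Finset.mem_univ, true_and, Finset.mem_union, soloInformedLabMerge]
      split_ifs with h3 <;> omega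
    rw [hS, Finset.card_union_of_disjoint (Finset.disjoint_filter.2 fun l _ h1 h2 => by omega),
      soloInformed_card_filter_le_val (show (m + 1) + c = M + 1 by omega),
      soloInformed_card_fibreU hu.1 hw hk (by omega : m + 1 ≤ M + 1) ht]
  · rw [← soloInformed_card_fibreU hu.1 hw hk (by omega : m + 1 ≤ M + 1) ht]
    congr 1
    ext l
    simp only [Finset.mem_filter, Finset.mem_univ, true_and, soloInformedLabMerge]
    split_ifs with h3 <;> omega

/-- `LabIns i` is a valid labelling with blocks `0,…,k+1` when `c ≥ 1` and `i ≥ 1`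
(block `0` is then `u₀ ≥ 2`). -/
theorem soloInformed_isLab_labInsC (hc : 1 ≤ c) (hi1 : 1 ≤ i) (hi : i ≤ k + 1) :
    soloInformedIsLab (soloInformedLabIns M u m i) (k + 1) := by
  refine ⟨fun l => ?_, fun t ht => ?_, ?_⟩
  · unfold soloInformedLabIns
    split_ifs with h1 h2
    · have := soloInformed_labU_le hu.1 hw hk (N := M + 1) h1; omega
    · have := soloInformed_labU_le hu.1 hw hk (N := M + 1) h1; omega
    · exact hi
  · rw [soloInformed_fib_labInsC M hu hw hk hM hi ht]
    split_ifs with h1 h2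
    · exact hu.1 _ (List.getElem_mem _)
    · exact hc
    · exact hu.1 _ (List.getElem_mem _)
  · rw [soloInformed_fib_labInsC M hu hw hk hM hi (Nat.zero_le _)]
    split_ifs with h1 h2
    · have h := hu.2 (List.ne_nil_of_length_eq_add_one hk)
      rwa [List.head_eq_getElem] at h
    · omega
    · omega

/-- `LabMerge i` is a valid labelling with blocks `0,…,k` (any letter size `c`). -/
theorem soloInformed_isLab_labMergeC (hi : i ≤ k) :
    soloInformedIsLab (soloInformedLabMerge M u m i) k := by
  refine ⟨fun l => ?_, fun t ht => ?_, ?_⟩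
  · unfold soloInformedLabMerge
    split_ifs with h1
    · exact soloInformed_labU_le hu.1 hw hk (N := M + 1) h1
    · exact hi
  · rw [soloInformed_fib_labMergeC M hu hw hk hM hi ht]
    have := hu.1 _ (List.getElem_mem (l := u) (n := t) (by omega))
    split_ifs <;> omega
  · rw [soloInformed_fib_labMergeC M hu hw hk hM hi (Nat.zero_le _)]
    have h := hu.2 (List.ne_nil_of_length_eq_add_one hk)
    rw [List.head_eq_getElem] at h
    split_ifs <;> omega

/-- **The index of `LabIns i` is `u.take i ++ c :: u.drop i`.** -/
theorem soloInformed_idx_labInsC (hi : i ≤ k + 1) :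
    soloInformedIdx (soloInformedLabIns M u m i) (k + 2) = u.take i ++ c :: u.drop i := by
  apply List.ext_getElem?
  intro t
  by_cases ht : t < k + 2
  · rw [List.getElem?_eq_getElem (by simpa using ht), soloInformed_idx_getElem,
      soloInformed_fib_labInsC M hu hw hk hM hi (by omega : t ≤ k + 1)]
    split_ifs with h1 h2
    · rw [List.getElem?_append_left (by simp only [List.length_take]; omega), List.getElem?_take, if_pos h1,
        List.getElem?_eq_getElem]
    · subst h2
      rw [List.getElem?_append_right (by simp only [List.length_take]; omega)]
      simp [Nat.min_eq_left (show t ≤ u.length by omega)]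
    · rw [List.getElem?_append_right (by simp only [List.length_take]; omega)]
      have e1 : t - (u.take i).length = (t - i - 1) + 1 := by simp only [List.length_take]; omega
      rw [e1, List.getElem?_cons_succ, List.getElem?_drop, List.getElem?_eq_getElem (by omega)]
      congr 2
      omega
  · rw [List.getElem?_eq_none (by simpa using ht), List.getElem?_eq_none (by
      simp only [List.length_append, List.length_cons, List.length_take, List.length_drop]; omega)]

/-- **The index of `LabMerge i` is `u.take i ++ (c + u_i) :: u.drop (i+1)`.** -/
theorem soloInformed_idx_labMergeC (hi : i ≤ k) :
    soloInformedIdx (soloInformedLabMerge M u m i) (k + 1) =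
      u.take i ++ (c + u[i]'(by omega)) :: u.drop (i + 1) := by
  apply List.ext_getElem?
  intro t
  by_cases ht : t < k + 1
  · rw [List.getElem?_eq_getElem (by simpa using ht), soloInformed_idx_getElem,
      soloInformed_fib_labMergeC M hu hw hk hM hi (by omega : t ≤ k)]
    split_ifs with h1
    · subst h1
      rw [List.getElem?_append_right (by simp only [List.length_take]; omega)]
      simp [Nat.min_eq_left (show t ≤ u.length by omega)]
    · rcases lt_or_gt_of_ne h1 with h2 | h2
      · rw [List.getElem?_append_left (by simp only [List.length_take]; omega), List.getElem?_take, if_pos h2,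
          List.getElem?_eq_getElem]
      · rw [List.getElem?_append_right (by simp only [List.length_take]; omega)]
        have e1 : t - (u.take i).length = (t - i - 1) + 1 := by simp only [List.length_take]; omega
        rw [e1, List.getElem?_cons_succ, List.getElem?_drop, List.getElem?_eq_getElem (by omega)]
        congr 2
        omega
  · rw [List.getElem?_eq_none (by simpa using ht), List.getElem?_eq_none (by
      simp only [List.length_append, List.length_cons, List.length_take, List.length_drop]; omega)]

/-- **Chain products of `LabIns i`** (any letter size): `Q_t` below `i`; `Q_{t-1}·Y`
(`Q_{-1} = 1`) from `i` on. -/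
theorem soloInformed_BP_labInsC (hi : i ≤ k + 1) (w : Fin (M + 1) → ℝ) {t : ℕ} (ht : t ≤ k + 1) :
    soloInformedBP (soloInformedLabIns M u m i) w t =
      if t < i then soloInformedQU M u w t
      else (if t = 0 then 1 else soloInformedQU M u w (t - 1)) * soloInformedYB M m w := by
  unfold soloInformedBP
  split_ifs with h1 h2
  · rw [soloInformedQU, ← soloInformed_filter_labU_le hu.1 hw hk (by omega : t ≤ k)]
    congr 1
    ext l
    simp only [Finset.mem_filter, Finset.mem_univ, true_and, soloInformedLabIns]
    split_ifs with h3 h4 <;> omega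
  · subst h2
    rw [one_mul, soloInformedYB]
    congr 1
    ext l
    simp only [Finset.mem_filter, Finset.mem_univ, true_and, soloInformedLabIns]
    split_ifs with h3 h4 <;> omega
  · rw [soloInformedQU, soloInformedYB, ← Finset.prod_union (Finset.disjoint_filter.2
      fun l _ h3 h4 => by have := soloInformed_ends_getD_le_weight hu.1 hw hk (t - 1); omega)]
    congr 1
    ext l
    simp only [Finset.mem_filter, Finset.mem_univ, true_and, Finset.mem_union, soloInformedLabIns]
    have key : l.1 < m + 1 → (soloInformedLabU u l < t ↔ l.1 < (soloInformedEnds u).getD (t - 1) 0) :=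
      fun hl => by
        have := soloInformed_labU_le_iff hu.1 hw hk (N := M + 1) hl (t := t - 1) (by omega)
        omega
    have hle := soloInformed_ends_getD_le_weight hu.1 hw hk (t - 1)
    split_ifs with h3 h4
    · constructor
      · intro; exact Or.inl ((key h3).1 (by omega))
      · rintro (h | h)
        · omega
        · omega
    · constructor
      · intro h; exact Or.inl ((key h3).1 (by omega))
      · rintro (h | h)
        · have := (key h3).2 h; omega
        · omega
    · constructor
      · intro; exact Or.inr (by omega)
      · intro; omega

/-- **Chain products of `LabMerge i`** (any letter size): `Q_t`, times `Y` from `i` on. -/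
theorem soloInformed_BP_labMergeC (w : Fin (M + 1) → ℝ) {t : ℕ} (ht : t ≤ k) :
    soloInformedBP (soloInformedLabMerge M u m i) w t =
      if t < i then soloInformedQU M u w t else soloInformedQU M u w t * soloInformedYB M m w := by
  unfold soloInformedBP
  split_ifs with h1
  · rw [soloInformedQU, ← soloInformed_filter_labU_le hu.1 hw hk ht]
    congr 1
    ext l
    simp only [Finset.mem_filter, Finset.mem_univ, true_and, soloInformedLabMerge]
    split_ifs with h3 <;> omega
  · rw [soloInformedQU, soloInformedYB, ← soloInformed_filter_labU_le hu.1 hw hk ht,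
      ← Finset.prod_union (Finset.disjoint_filter.2 fun l _ h3 h4 => by omega)]
    congr 1
    ext l
    simp only [Finset.mem_filter, Finset.mem_univ, true_and, Finset.mem_union, soloInformedLabMerge]
    split_ifs with h3 <;> omega

end labs

/-! ## The Hoffman case: `M = m + 1`, one extra coordinate `Y = w_{m+1}`, letter of size `1`

(The general-letter chain lemmas `soloInformed_ofFn_BP_labIns/Merge` of `SoloInformedHarmonicReps`
carry the hypothesis `m + a + 2 = M`, which has no solution for `M = m + 1`; the two lemmas below are
their size-`1` counterparts, with `Y` the last coordinate.) -/

section hoffman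

variable {u : List ℕ} {m k : ℕ} (hu : MZV.IsAdmissible u) (hw : u.sum = m + 1) (hk : u.length = k + 1)

/-- `Y = w_{m+1}`: for `M = m + 1` the `X`-block is the single last coordinate. -/
theorem soloInformed_YB_last (w : Fin (m + 2) → ℝ) :
    soloInformedYB (m + 1) m w = w (Fin.last (m + 1)) := by
  unfold soloInformedYB
  have h : Finset.univ.filter (fun l : Fin (m + 1 + 1) => m + 1 ≤ l.1) = {Fin.last (m + 1)} := by
    ext l
    simp only [Finset.mem_filter, Finset.mem_univ, true_and, Finset.mem_singleton, Fin.ext_iff,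
      Fin.val_last]
    omega
  rw [h, Finset.prod_singleton]

include hu hw hk in
/-- **The chain of `LabIns (m+1) u m i` is `ins_i(w_{m+1}; Q)` with inserted letter `1`.** -/
theorem soloInformed_ofFn_BP_labIns_one (i : Fin (k + 2)) (w : Fin (m + 2) → ℝ) :
    List.ofFn (fun t : Fin (k + 2) => soloInformedBP (soloInformedLabIns (m + 1) u m i) w t) =
      soloInformedInsQ (w (Fin.last (m + 1))) 1
        (List.ofFn fun t : Fin (k + 1) => soloInformedQU (m + 1) u w t) i := by
  rw [← soloInformed_YB_last w]
  apply List.ext_getElem?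
  intro r
  rw [List.getElem?_ofFn, soloInformed_getElem?_insQ _ _ _ _ _ (by simp; omega)]
  by_cases hr : r < k + 2
  · rw [dif_pos hr, soloInformed_BP_labInsC (m + 1) (c := 1) hu hw hk rfl (Nat.le_of_lt_succ i.2) w
      (by omega : r ≤ k + 1)]
    by_cases h1 : r < i
    · rw [if_pos h1, if_pos h1, List.getElem?_ofFn, dif_pos (by omega)]
    rw [if_neg h1, if_neg h1]
    by_cases h2 : r = i
    · rw [if_pos h2, ← h2]
      rcases Nat.eq_zero_or_pos r with rfl | hpos
      · rw [if_pos rfl, List.getD_cons_zero]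
      · obtain ⟨s, rfl⟩ : ∃ s, r = s + 1 := ⟨r - 1, by omega⟩
        rw [if_neg (by omega), List.getD_cons_succ, List.getD_eq_getElem _ _ (by simp; omega),
          List.getElem_ofFn, Nat.add_sub_cancel]
    · rw [if_neg h2, if_neg (by omega : r ≠ 0), List.getElem?_ofFn, dif_pos (by omega : r - 1 < k + 1)]
      rfl
  · rw [dif_neg hr, if_neg (by omega), if_neg (by omega), List.getElem?_ofFn, dif_neg (by omega)]
    rfl

include hu hw hk in
/-- **The chain of `LabMerge (m+1) u m i` is `merge_i(w_{m+1}; Q)`.** -/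
theorem soloInformed_ofFn_BP_labMerge_one (i : Fin (k + 1)) (w : Fin (m + 2) → ℝ) :
    List.ofFn (fun t : Fin (k + 1) => soloInformedBP (soloInformedLabMerge (m + 1) u m i) w t) =
      soloInformedMergeQ (w (Fin.last (m + 1)))
        (List.ofFn fun t : Fin (k + 1) => soloInformedQU (m + 1) u w t) i := by
  rw [← soloInformed_YB_last w]
  apply List.ext_getElem?
  intro r
  rw [List.getElem?_ofFn, soloInformed_getElem?_mergeQ, List.getElem?_ofFn]
  by_cases hr : r < k + 1
  · rw [dif_pos hr, dif_pos hr, soloInformed_BP_labMergeC (m + 1) (c := 1) hu hw hk rfl w (by omega : r ≤ k)]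
    split_ifs with h1
    · rfl
    · rfl
  · rw [dif_neg hr, dif_neg hr]
    split_ifs <;> rfl

end hoffman


end Summit.KontsevichZagierPeriods.KontsevichZagierPeriods.Theorems
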